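import Summits.FinalStateConjecture.FinalStateConjecture.Theorems.SwallowTheDatumSubdataDevelopmentsEmbedLocalisation
import Literature.Geometry.Lorentzian.CauchyDevelopmentGlobalHyperbolicityProofs

/-!
# Route SwallowTheDatum · item `SubdataDevelopmentsEmbed` (stmt-FinalStateConjecture-10053) —
# the item from MGHD existence ALONE

`subdataDevelopmentsEmbed_of_choquetBruhatGeroch_of_causalCompact` (`…Localisation.lean`) proves
the item from the named facts `choquetBruhat_geroch_exists_mghd_cauchy` (existence of maximal
globally hyperbolic vacuum developments, Choquet-Bruhat–Geroch 1969, Thm. 3) and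
`hawkingEllis_cauchyDevelopment_causalCompact_closed` (global hyperbolicity of Cauchy
developments, Hawking–Ellis 1973, Prop. 6.6.6 / O'Neill 1983, Lemma 14.22). The second is a
THEOREM of the tree (`hawkingEllis_cauchyDevelopment_causalCompact_closed_holds`,
`CauchyDevelopmentGlobalHyperbolicityProofs`); substituting it:

* `subdataDevelopmentsEmbed_of_choquetBruhatGeroch :
    choquetBruhat_geroch_exists_mghd_cauchy → SubdataDevelopmentsEmbed` —

**the item hinges on the single registered fact `choquetBruhat_geroch_exists_mghd_cauchy`**, the
same (and only) blocker of `MGHDExistence` (stmt-FinalStateConjecture-9937); no local geometric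
uniqueness statement and no form of Sbierski's Theorem 12 enters this line. Closing line, once
`choquetBruhat_geroch_exists_mghd_cauchy_holds` exists:
`subdataDevelopmentsEmbed_of_choquetBruhatGeroch choquetBruhat_geroch_exists_mghd_cauchy_holds`.

Pure composition; no definition; no new named fact.
-/

noncomputable section

open scoped Manifold ContDiff Topology

namespace Summit.FinalStateConjecture.FinalStateConjecture.Theorems

namespace SubdataDevelopmentsEmbed

open Literature.Geometry.Lorentzian

/-- **`SubdataDevelopmentsEmbed` from the existence of maximal globally hyperbolic vacuum
developments alone**: `subdataDevelopmentsEmbed_of_choquetBruhatGeroch_of_causalCompact` with its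
global-hyperbolicity hypothesis discharged by the theorem
`hawkingEllis_cauchyDevelopment_causalCompact_closed_holds`. Hawking–Ellis 1973, §7.6, p. 251
("the maximal development of `𝓢'` can be mapped into that of `𝓢`"); Choquet-Bruhat–Geroch 1969,
Thm. 3 and p. 334. [cite: HawkingEllis1973CUP, §7.6, pp. 249–251]
[cite: ChoquetBruhatGeroch1969CMP, Thm. 3 and p. 334] -/
theorem subdataDevelopmentsEmbed_of_choquetBruhatGeroch
    (hcbg : choquetBruhat_geroch_exists_mghd_cauchy) :
    Summit.FinalStateConjecture.FinalStateConjecture.Theses.SwallowTheDatum.SubdataDevelopmentsEmbed :=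
  subdataDevelopmentsEmbed_of_choquetBruhatGeroch_of_causalCompact hcbg
    hawkingEllis_cauchyDevelopment_causalCompact_closed_holds

end SubdataDevelopmentsEmbed

end Summit.FinalStateConjecture.FinalStateConjecture.Theorems

end
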